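import Summits.HodgeConjecture.HodgeConjecture.Theorems.VHCAbelianSchemesRoadIsogenyTwistJetPushforwardComparison
import Summits.HodgeConjecture.HodgeConjecture.Theorems.VHCAbelianSchemesRoadIsogenyTwistWedgeCompat
import HarnessLib

/-!
# Road №4 (`VHCAbelianSchemesRoad`) — the displayed input (W) `IsogenyTwistWedgeDCompat hΩ` of (c1At) IS A THEOREM
# (crux stmt-HodgeConjecture-26512; research route conditional on HC_CM; not a corollary; Q11.4-sentence-2 already refuted in dim ≥ 3)

Seat core-w6 (width copy of core-D). Core-qb's `Theorems/VHCAbelianSchemesRoadIsogenyTwistJetPushforwardComparison.lean` (p654491) reduced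
the registered stub (c1At) `stub_atiyahPair hΩ` of skeleton v3.13 to ONE displayed module-level input on the twist datum
`α₀ = isogenyTwistPushforwardIsoFamily hΩ` (p650171): (W) `IsogenyTwistWedgeDCompat hΩ` («the twisting terms `da ∧ –` correspond under α₀»).
This one-screen file discharges it BY NAME from core-w6's theorem `isogenyTwistHodgePushforwardIso_hom_app_wedgeD`
(`Theorems/VHCAbelianSchemesRoadIsogenyTwistWedgeCompat.lean`, p654817), whose statement is the body of (W) with the quantifiers as binders.

`--supports stmt-HodgeConjecture-26512 --as helper`; closes NO stub by itself (core-qb files the verbatim closer of `stub_atiyahPair` over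
`atiyahClassPushforwardCompatPair_routeK_of_wedgeD`); CONDITIONAL on nothing beyond the road's named fact «`Ω¹_A` free»
(`hΩ : Mumford1970_cotangentSheaf_abelianVariety_free`, the registered stub (c1Ω), a HYPOTHESIS of the Prop (W) itself, not concluded here);
nothing here says (c1At), (c1Tr), (c1), T′, `HC_AV`, `HC_CM` or HC holds; HC_CM HELD, by name only; typed ≠ proved.

References: [cite: BuchweitzFlenner2003, §3 (twisted jet sequences; functoriality in the scheme)] [cite: Hartshorne1977, II Ex. 5.1, II Ex. 5.16 (e), III Prop. 10.4]
[cite: MumfordAV1970, §4 (iii) (p. 42)].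
-/

namespace Summit.HodgeConjecture.HodgeConjecture.Ring2.SemiregularRepresentatives

set_option linter.dupNamespace false -- the cell's namespace repeats the summit name, as in every `Ring2*` file

open Literature.AlgebraicGeometry.Motives

/-- **(W) holds: the twisting terms correspond under `α₀`** — core-qb's displayed input `IsogenyTwistWedgeDCompat hΩ` of (c1At), by
`isogenyTwistHodgePushforwardIso_hom_app_wedgeD` (p654817). CONDITIONAL on `hΩ` only (a hypothesis inside the Prop).
[cite: BuchweitzFlenner2003, §3 (twisted jet sequences; functoriality in the scheme)] [cite: Hartshorne1977, II Ex. 5.16 (e), III Prop. 10.4] -/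
theorem isogenyTwistWedgeDCompat_holds (hΩ : Mumford1970_cotangentSheaf_abelianVariety_free) : IsogenyTwistWedgeDCompat hΩ :=
  fun A g hg _ hE j U a φ => isogenyTwistHodgePushforwardIso_hom_app_wedgeD hΩ A g hg _ hE j U a φ

/-- **(c1At)'s pair law for `α₀` over the route-K pair, UNCONDITIONALLY in `hΩ`**: core-qb's residual
`atiyahClassPushforwardCompatPair_routeK_of_wedgeD` (p654491) fed with (W). This is the body of the registered stub `stub_atiyahPair hΩ`
(skeleton v3.13) — stated here only as the composite term's type, for the record; the closer file binding the stub BY NAME is core-qb's.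
[cite: BuchweitzFlenner2003, §3 and Def. 4.1] [cite: Atiyah1957, §4 Prop. 6–7] -/
theorem atiyahClassPushforwardCompatPair_routeK_of_wedgeD_holds (hΩ : Mumford1970_cotangentSheaf_abelianVariety_free) :
    AtiyahClassPushforwardCompatPair isogenyDerivedAdjointPairOfRouteK (isogenyTwistPushforwardIsoFamily hΩ) :=
  atiyahClassPushforwardCompatPair_routeK_of_wedgeD hΩ (isogenyTwistWedgeDCompat_holds hΩ)

end Summit.HodgeConjecture.HodgeConjecture.Ring2.SemiregularRepresentatives
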